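import Summits.ValiantsHypothesis.ValiantsHypothesis.Theorems.DepthWindowLowBiasRound

/-!
# Route `DepthWindow` — the MASS PROFILE of a word bounds every low-bias tree from below

Cone-free helper (decomp-valiant lens 4, g15; adversary side of the window `(1, 2]`) supporting the crux item
`HomImmHardTwoOne` (stmt-ValiantsHypothesis-30635).  The builders of this route (`DepthWindowTwoLetterULB`,
`DepthWindowBoundedLetters`) show what a universal low-bias tree CAN do; this file isolates the one counting
constraint every low-bias tree MUST obey, in a form an adversary word can be tested against:

* `levelMass_le` — in a tree all of whose level-`(ℓ+1)` node biases are `≤ β`, the `ℓ¹`-mass of level `ℓ`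
  (`Σ_blocks |Sum(block)|`) is at most `β ·` (number of level-`(ℓ+1)` blocks): COARSE levels must be paid for by
  CANCELLATION one level below;
* `levelCount_succ_le` — block counts decrease upwards;
* `exists_countChain_of_lowBiasTree` — hence a `LowBiasTree w Δ β` yields a chain of block counts
  `d = N₀ ≥ N₁ ≥ … ≥ N_Δ ≤ 1` with `P(N_ℓ) ≤ β · N_{ℓ+1}` for every MASS PROFILE `P` of the word (`P(N) ≤` the
  `ℓ¹`-mass of every presentation of the letters in `N` blocks).  A word whose profile makes such a chain
  impossible in `Δ` steps has `Treebias_Δ > β`-type lower bounds (via `treeBiasGe_of_nodeBias`); with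
  `P(N) ≈ h·d·(N/d)^α` the chain needs `≈ log₂log₂ d / log₂ α` steps, so slope `2` on the adversary side asks for
  IMM-fitting words with `α ≤ √2` at all scales (two-letter golden words have `α = 2`: BDS 2024 Thm. 1.4).

References: [LimayeSrinivasanTavenas2022] full version ECCC TR22-090 Def. 15, Prop. 17; [BhargavDuttaSaxena2024]
ACM ToCT 16(4):23 Thm. 1.4.
-/

-- layout Summits/ValiantsHypothesis/ValiantsHypothesis forces the duplicated namespace component
set_option linter.dupNamespace false

namespace Summit.ValiantsHypothesis.ValiantsHypothesis.Theorems.DepthWindow.TreeBias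

open Finset

variable {d : ℕ}

/-! ### Level masses and level counts -/

/-- The number of blocks of `T` at level `ℓ`. [folklore] -/
def levelCount (T : LTree d) (ℓ : ℕ) : ℕ := (univ.image (T.lab ℓ)).card

/-- The `ℓ¹`-mass of level `ℓ`: the sum over the level-`ℓ` blocks of `|Sum(block)|`. [folklore] -/
def levelMass (w : Fin d → ℤ) (T : LTree d) (ℓ : ℕ) : ℤ :=
  ∑ l ∈ univ.image (T.lab ℓ), |blockSum w T ℓ l|

/-- Level `0` has `d` blocks. [folklore] -/
theorem levelCount_zero (T : LTree d) : levelCount T 0 = d := by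
  unfold levelCount
  rw [show T.lab 0 = id from funext T.leaf, image_id, card_univ, Fintype.card_fin]

/-- A single-block level has at most one block. [folklore] -/
theorem levelCount_le_one_of_root (T : LTree d) {Δ : ℕ} (hroot : ∀ i j, T.lab Δ i = T.lab Δ j) :
    levelCount T Δ ≤ 1 := by
  unfold levelCount
  refine card_le_one.2 fun a ha b hb => ?_
  obtain ⟨i, -, rfl⟩ := mem_image.1 ha
  obtain ⟨j, -, rfl⟩ := mem_image.1 hb
  exact hroot i j

/-- The level-`0` mass is `‖w‖₁`. [folklore] -/
theorem levelMass_zero (w : Fin d → ℤ) (T : LTree d) : levelMass w T 0 = ∑ j, |w j| := by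
  unfold levelMass
  rw [show T.lab 0 = id from funext T.leaf, image_id]
  exact sum_congr rfl fun l _ => by rw [blockSum_zero]

/-- **Counts decrease upwards**: level `ℓ + 1` has at most as many blocks as level `ℓ`. [folklore] -/
theorem levelCount_succ_le (T : LTree d) (ℓ : ℕ) : levelCount T (ℓ + 1) ≤ levelCount T ℓ := by
  classical
  unfold levelCount
  -- parent of a level-`ℓ` label (identity off the image)
  let π : Fin d → Fin d := fun l => if h : ∃ j, T.lab ℓ j = l then T.lab (ℓ + 1) (Classical.choose h) else l
  have hsub : univ.image (T.lab (ℓ + 1)) ⊆ (univ.image (T.lab ℓ)).image π := by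
    intro L hL
    obtain ⟨j, -, rfl⟩ := mem_image.1 hL
    refine mem_image.2 ⟨T.lab ℓ j, mem_image_of_mem _ (mem_univ j), ?_⟩
    have h : ∃ j', T.lab ℓ j' = T.lab ℓ j := ⟨j, rfl⟩
    simp only [π, dif_pos h]
    exact T.refine ℓ _ _ (Classical.choose_spec h)
  exact (card_le_card hsub).trans card_image_le

/-- **Coarse levels are paid for by cancellation below**: if every level-`(ℓ+1)` node bias is `≤ β`, the level-`ℓ`
mass is at most `β ·` (number of level-`(ℓ+1)` blocks). [cite: LimayeSrinivasanTavenas2022, Def. 15] -/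
theorem levelMass_le (w : Fin d → ℤ) (T : LTree d) (ℓ : ℕ) {β : ℤ} (hnb : ∀ i, nodeBias w T (ℓ + 1) i ≤ β) :
    levelMass w T ℓ ≤ β * levelCount T (ℓ + 1) := by
  classical
  unfold levelMass levelCount
  -- the level-`ℓ` labels, grouped by their parent block
  have hcover : univ.image (T.lab ℓ) = (univ.image (T.lab (ℓ + 1))).biUnion
      fun L => (univ.filter fun j => T.lab (ℓ + 1) j = L).image (T.lab ℓ) := by
    ext l
    simp only [mem_image, mem_univ, true_and, mem_biUnion, mem_filter]
    constructor
    · rintro ⟨j, rfl⟩; exact ⟨T.lab (ℓ + 1) j, ⟨j, rfl⟩, j, rfl, rfl⟩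
    · rintro ⟨L, -, j, -, rfl⟩; exact ⟨j, rfl⟩
  have hdisj : (↑(univ.image (T.lab (ℓ + 1))) : Set (Fin d)).PairwiseDisjoint
      fun L => (univ.filter fun j => T.lab (ℓ + 1) j = L).image (T.lab ℓ) := by
    intro L _ L' _ hne
    rw [Function.onFun, disjoint_left]
    intro l hl hl'
    obtain ⟨j, hj, rfl⟩ := mem_image.1 hl
    obtain ⟨j', hj', hjj'⟩ := mem_image.1 hl'
    have := T.refine ℓ j' j hjj'
    rw [(mem_filter.1 hj).2, (mem_filter.1 hj').2] at this
    exact hne this.symm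
  rw [hcover, sum_biUnion hdisj]
  calc ∑ L ∈ univ.image (T.lab (ℓ + 1)), ∑ l ∈ (univ.filter fun j => T.lab (ℓ + 1) j = L).image (T.lab ℓ),
          |blockSum w T ℓ l|
      ≤ ∑ L ∈ univ.image (T.lab (ℓ + 1)), β := by
        refine sum_le_sum fun L hL => ?_
        obtain ⟨i, -, rfl⟩ := mem_image.1 hL
        have := hnb i
        unfold nodeBias at this
        rwa [show ℓ + 1 - 1 = ℓ from rfl] at this
    _ = β * (univ.image (T.lab (ℓ + 1))).card := by rw [sum_const, nsmul_eq_mul, mul_comm]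

/-! ### Mass profiles and the count chain -/

/-- **The count chain of a low-bias tree.**  If `w` has a depth-`Δ` tree with all node biases `≤ β` and `P` is a
MASS PROFILE of `w` (every presentation of the letters in blocks — a labelling `lab`, blocks = label classes —
has `ℓ¹`-mass `Σ_blocks |Sum| ≥ P (number of blocks)`), then there are block counts `N₀ = d ≥ N₁ ≥ … ≥ N_Δ ≤ 1`
with `P(N_ℓ) ≤ β·N_{ℓ+1}` for all `ℓ < Δ` — the recursion every universal builder runs, read as a constraint. [cite: LimayeSrinivasanTavenas2022,
Def. 15, Prop. 17] -/
theorem exists_countChain_of_lowBiasTree {w : Fin d → ℤ} {Δ : ℕ} {β : ℤ} (hT : LowBiasTree w Δ β) {P : ℕ → ℤ}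
    (hP : ∀ lab : Fin d → Fin d,
      P (univ.image lab).card ≤ ∑ l ∈ univ.image lab, |∑ j ∈ univ.filter (fun j => lab j = l), w j|) :
    ∃ N : ℕ → ℕ, N 0 = d ∧ N Δ ≤ 1 ∧ (∀ ℓ, N (ℓ + 1) ≤ N ℓ) ∧ ∀ ℓ, ℓ < Δ → P (N ℓ) ≤ β * N (ℓ + 1) := by
  obtain ⟨T, hroot, hnb⟩ := hT
  refine ⟨levelCount T, levelCount_zero T, levelCount_le_one_of_root T hroot, levelCount_succ_le T,
    fun ℓ hℓ => ?_⟩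
  calc P (levelCount T ℓ) ≤ levelMass w T ℓ := hP (T.lab ℓ)
    _ ≤ β * levelCount T (ℓ + 1) := levelMass_le w T ℓ fun i => hnb (ℓ + 1) (by omega) hℓ i

/-- **Iterated form.**  Let `F` be monotone with `F N ≤ n` whenever `P N ≤ β · n` (e.g. `F N = ⌈P(N)/β⌉`): the least
number of blocks the level above a level of `N` blocks can have.  Then a depth-`Δ` tree with node biases `≤ β`
forces `F^[Δ] d ≤ 1`; equivalently `F^[Δ] d ≥ 2` excludes every such tree.  With `P(N) ≈ h·d·(N/d)^α` and
`β = B·h` this is `Δ ≳ log₂log₂ d / log₂ α`. [cite: LimayeSrinivasanTavenas2022, Prop. 17] -/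
theorem iterate_le_one_of_lowBiasTree {w : Fin d → ℤ} {Δ : ℕ} {β : ℤ} (hT : LowBiasTree w Δ β) {P : ℕ → ℤ}
    (hP : ∀ lab : Fin d → Fin d,
      P (univ.image lab).card ≤ ∑ l ∈ univ.image lab, |∑ j ∈ univ.filter (fun j => lab j = l), w j|)
    {F : ℕ → ℕ} (hF : Monotone F) (hFP : ∀ N n : ℕ, P N ≤ β * n → F N ≤ n) : F^[Δ] d ≤ 1 := by
  obtain ⟨N, hN0, hNΔ, -, hchain⟩ := exists_countChain_of_lowBiasTree hT hP
  have key : ∀ ℓ, ℓ ≤ Δ → F^[ℓ] d ≤ N ℓ := by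
    intro ℓ
    induction ℓ with
    | zero => intro; simp [hN0]
    | succ ℓ ih =>
      intro hℓ
      rw [Function.iterate_succ_apply']
      exact (hF (ih (by omega))).trans (hFP _ _ (hchain ℓ (by omega)))
  exact (key Δ le_rfl).trans hNΔ

/-- The same, contrapositive and in tree-bias currency: if NO count chain of length `Δ` is compatible with a mass
profile of `w` at node-bias budget `β`, then every depth-`Δ` `w`-tree has a node of bias `> β`, so
`Treebias_Δ(w) ≥ τ` whenever `τ + |Σ w| ≤ β + 1`. [cite: LimayeSrinivasanTavenas2022, Prop. 17] -/
theorem treeBiasGe_of_no_countChain {w : Fin d → ℤ} {Δ : ℕ} {β : ℤ} {P : ℕ → ℤ}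
    (hP : ∀ lab : Fin d → Fin d,
      P (univ.image lab).card ≤ ∑ l ∈ univ.image lab, |∑ j ∈ univ.filter (fun j => lab j = l), w j|)
    (hno : ¬ ∃ N : ℕ → ℕ, N 0 = d ∧ N Δ ≤ 1 ∧ (∀ ℓ, N (ℓ + 1) ≤ N ℓ) ∧ ∀ ℓ, ℓ < Δ → P (N ℓ) ≤ β * N (ℓ + 1))
    {τ : ℕ} (hτ : (τ : ℤ) + |∑ j, w j| ≤ β + 1) : TreeBiasGe w Δ τ := by
  refine treeBiasGe_of_nodeBias fun T hroot => ?_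
  by_contra hlt
  push Not at hlt
  refine hno (exists_countChain_of_lowBiasTree ⟨T, hroot, fun u hu1 hu i => ?_⟩ hP)
  have := hlt u i hu1 hu
  omega

end Summit.ValiantsHypothesis.ValiantsHypothesis.Theorems.DepthWindow.TreeBias
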